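/-
Copyright: harness cell b2b-lgcu-borel (gen 14).  Honest framing: the VALUE here is a THEOREM
(hypothesis-free structure lemmas for elements of order `p` of `GL₂(𝔽_p)` inside subgroups) —
NOT summit progress; the crux `SubgroupIdentityDesigns` (stmt-MatrixMultiplication-14079) is open.
-/
import Summits.MatrixMultiplication.MatrixMultiplication.Theorems.SubgroupIdentityDesigns.Negative.DecoratedSylowShapes

/-!
# Transvections of `GL₂(𝔽_p)` inside subgroups: fixed lines, root subgroups, the root lemma

Entry-level (definition-free) lemmas feeding the hypothesis-free three-Sylow packing law
(`Negative/ThreeSylowLaw.lean`), in the coordinates of `DecoratedSylowShapes` (`U⁺`: `u₁₀ = 0`,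
`u₀₀ = u₁₁ = 1`; `U⁻`: `u₀₁ = 0`, `u₀₀ = u₁₁ = 1`):

* `exists_transvection`: `p ∣ |H|` gives `g ∈ H`, `g ≠ 1`, `det g = 1`, with a fixed vector
  `v ≠ 0` (Cauchy; `(g - 1)^p = g^p - 1 = 0` in characteristic `p`, so `det (g - 1) = 0`;
  `det g = (det g)^p = det g^p = 1`);
* `conj_upper_of_fixed_col`: if `g` (`det g = 1`) fixes the first column of `z` then `z⁻¹ g z ∈ U⁺`
  (so every element of order `p` is a transvection, with no appeal to Sylow or Jordan theory);
* `upper_mem_of_mem`: one element of `U⁺ ∖ 1` in a subgroup `L` puts all of `U⁺` in `L` (powers);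
* `lower_mem_of_upper_mem` — THE ROOT LEMMA: `U⁺ ≤ L` and some `h ∈ L` with `h₁₀ ≠ 0` put all of
  `U⁻` in `L`, by the identity `E₂₁(s) = g E₁₂(s g₀₁/h₁₀) g⁻¹`, `g = E₁₂(-h₀₀/h₁₀) h ∈ L`;
* `upper_le_map_conj`, `not_disjoint_of_common_fixed`: two subgroups containing non-trivial
  elements of determinant `1` with a common fixed vector meet non-trivially;
* `fixed_of_det_eq_zero`, `exists_gl2_col`, and the conjugation formulas `conj_m_apply`
  (`m = [[1,0],[1,1]]`), `conj_w_apply` (`w = [[0,1],[1,0]]`) moving `U⁺` to `U_{[1:1]}` and `U⁻`.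

Report: `run/shared/lean/b2b/levelgraded-cu/ORACLE-g14.md` §G14-2.  Sorry-free; no new definitions.
-/

set_option linter.dupNamespace false

noncomputable section

open scoped BigOperators Classical
open Summit.MatrixMultiplication.MatrixMultiplication.Theorems.LieRankDesigns.Negative (GLm Mat)

namespace Summit.MatrixMultiplication.MatrixMultiplication.Theorems.SubgroupIdentityDesigns.Negative

section Transvections

open Literature.Barriers.MatrixMultiplication (SubgroupTPP)

/-! ### Generalities: conjugate subgroups, transport of the subgroup TPP -/

/-- Membership in the conjugate `c⁻¹ H c = H.map (conj c⁻¹)`: `x ∈ c⁻¹ H c ↔ c x c⁻¹ ∈ H`. -/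
theorem mem_map_conj_inv_iff {G : Type*} [Group G] {H : Subgroup G} {c x : G} :
    x ∈ H.map (MulAut.conj c⁻¹).toMonoidHom ↔ c * x * c⁻¹ ∈ H := by
  rw [Subgroup.mem_map_equiv, MulAut.conj_symm_apply, inv_inv]

/-- The subgroup TPP is transported along an injective homomorphism. -/
theorem subgroupTPP_map_of_injective {G G' : Type*} [Group G] [Group G'] (φ : G →* G')
    (hφ : Function.Injective φ) {H₁ H₂ H₃ : Subgroup G} (htpp : SubgroupTPP H₁ H₂ H₃) :
    SubgroupTPP (H₁.map φ) (H₂.map φ) (H₃.map φ) := by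
  rintro _ ⟨a, ha, rfl⟩ _ ⟨b, hb, rfl⟩ _ ⟨c, hc, rfl⟩ h
  rw [← map_mul, ← map_mul, map_eq_one_iff _ hφ] at h
  obtain ⟨rfl, rfl, rfl⟩ := htpp a ha b hb c hc h
  simp

variable {p : ℕ} [hp : Fact p.Prime]

/-! ### Elements of order `p`: fixed vector and determinant -/

/-- **Cauchy + characteristic `p`.**  If `p ∣ |H|` then `H` contains some `g ≠ 1` with `det g = 1`
and a non-zero fixed vector `v` (`g v = v`, written on entries). -/
theorem exists_transvection {H : Subgroup (GLm p 2)} (hd : p ∣ Nat.card H) :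
    ∃ g ∈ H, g ≠ 1 ∧ (g : Mat p 2).det = 1 ∧ ∃ v : Fin 2 → ZMod p, v ≠ 0 ∧
      ((g : Mat p 2) 0 0 * v 0 + (g : Mat p 2) 0 1 * v 1 = v 0 ∧
        (g : Mat p 2) 1 0 * v 0 + (g : Mat p 2) 1 1 * v 1 = v 1) := by
  obtain ⟨x, hx⟩ := exists_prime_orderOf_dvd_card' p hd
  have hg : orderOf (x : GLm p 2) = p := by
    rw [Subgroup.orderOf_coe]
    exact hx
  have hgp : ((x : GLm p 2) : Mat p 2) ^ p = 1 := by
    have h := pow_orderOf_eq_one (x : GLm p 2)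
    rw [hg] at h
    rw [← Units.val_pow_eq_pow_val, h, Units.val_one]
  refine ⟨x, x.2, ?_, ?_, ?_⟩
  · intro h1
    rw [h1, orderOf_one] at hg
    exact hp.out.ne_one hg.symm
  · have h := congr_arg Matrix.det hgp
    rw [Matrix.det_pow, Matrix.det_one, ZMod.pow_card] at h
    exact h
  · have hN : (((x : GLm p 2) : Mat p 2) - 1) ^ p = 0 := by
      rw [sub_pow_char_of_commute p (Commute.one_right _), one_pow, hgp, sub_self]
    have hdetN : (((x : GLm p 2) : Mat p 2) - 1).det = 0 := by
      have h := congr_arg Matrix.det hN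
      rw [Matrix.det_pow, Matrix.det_zero] at h
      exact (pow_eq_zero_iff hp.out.ne_zero).1 h
    obtain ⟨v, hv0, hv⟩ := Matrix.exists_mulVec_eq_zero_iff.2 hdetN
    refine ⟨v, hv0, ?_⟩
    rw [Matrix.sub_mulVec, Matrix.one_mulVec, sub_eq_zero] at hv
    have h0 := congr_fun hv 0
    have h1 := congr_fun hv 1
    simp only [Matrix.mulVec, dotProduct, Fin.sum_univ_two] at h0 h1
    exact ⟨h0, h1⟩

/-- A non-zero vector is the first column of some element of `GL₂(𝔽_p)`. -/
theorem exists_gl2_col {v : Fin 2 → ZMod p} (hv : v ≠ 0) :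
    ∃ z : GLm p 2, (z : Mat p 2) 0 0 = v 0 ∧ (z : Mat p 2) 1 0 = v 1 := by
  by_cases h0 : v 0 = 0
  · have h1 : v 1 ≠ 0 := fun h1 => hv (by funext i; fin_cases i <;> assumption)
    obtain ⟨z, z00, -, z10, -⟩ := exists_gl2 (v 0) 1 (v 1) 0
      (by rw [mul_zero, one_mul, zero_sub]; exact neg_ne_zero.2 h1)
    exact ⟨z, z00, z10⟩
  · obtain ⟨z, z00, -, z10, -⟩ := exists_gl2 (v 0) 0 (v 1) 1
      (by rw [mul_one, zero_mul, sub_zero]; exact h0)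
    exact ⟨z, z00, z10⟩

/-- Two proportional vectors (`det (v, w) = 0`, `v ≠ 0`) are fixed together. -/
theorem fixed_of_det_eq_zero {g : GLm p 2} {v w : Fin 2 → ZMod p} (hv : v ≠ 0)
    (hfix0 : (g : Mat p 2) 0 0 * v 0 + (g : Mat p 2) 0 1 * v 1 = v 0)
    (hfix1 : (g : Mat p 2) 1 0 * v 0 + (g : Mat p 2) 1 1 * v 1 = v 1)
    (hD : v 0 * w 1 - w 0 * v 1 = 0) :
    (g : Mat p 2) 0 0 * w 0 + (g : Mat p 2) 0 1 * w 1 = w 0 ∧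
      (g : Mat p 2) 1 0 * w 0 + (g : Mat p 2) 1 1 * w 1 = w 1 := by
  by_cases h0 : v 0 = 0
  · have h1 : v 1 ≠ 0 := fun h1 => hv (by funext i; fin_cases i <;> assumption)
    constructor
    · apply mul_right_cancel₀ h1
      linear_combination (w 1) * hfix0 + (1 - (g : Mat p 2) 0 0) * hD
    · apply mul_right_cancel₀ h1
      linear_combination (w 1) * hfix1 + (-(g : Mat p 2) 1 0) * hD
  · constructor
    · apply mul_right_cancel₀ h0
      linear_combination (w 0) * hfix0 + ((g : Mat p 2) 0 1) * hD
    · apply mul_right_cancel₀ h0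
      linear_combination (w 0) * hfix1 + ((g : Mat p 2) 1 1 - 1) * hD

/-! ### Normal form: a determinant-one element fixing the first column of `z` is conjugated by
`z` into `U⁺` -/

/-- If `det g = 1` and `g` fixes the first column of `z`, then `z⁻¹ g z` is upper unitriangular. -/
theorem conj_upper_of_fixed_col {g z : GLm p 2}
    (hfix0 : (g : Mat p 2) 0 0 * (z : Mat p 2) 0 0 + (g : Mat p 2) 0 1 * (z : Mat p 2) 1 0 =
      (z : Mat p 2) 0 0)
    (hfix1 : (g : Mat p 2) 1 0 * (z : Mat p 2) 0 0 + (g : Mat p 2) 1 1 * (z : Mat p 2) 1 0 =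
      (z : Mat p 2) 1 0)
    (hdet : (g : Mat p 2).det = 1) :
    ((z⁻¹ * g * z : GLm p 2) : Mat p 2) 1 0 = 0 ∧ ((z⁻¹ * g * z : GLm p 2) : Mat p 2) 0 0 = 1 ∧
      ((z⁻¹ * g * z : GLm p 2) : Mat p 2) 1 1 = 1 := by
  have hdk : ((z⁻¹ * g * z : GLm p 2) : Mat p 2).det = 1 := by
    rw [Units.val_mul, Units.val_mul, Matrix.det_mul, Matrix.det_mul, hdet, mul_one,
      ← Matrix.det_mul, ← Units.val_mul, inv_mul_cancel, Units.val_one, Matrix.det_one]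
  obtain ⟨k, hk⟩ : ∃ k : GLm p 2, k = z⁻¹ * g * z := ⟨_, rfl⟩
  rw [← hk] at hdk ⊢
  have e : z * k = g * z := by
    rw [hk]
    group
  have e00 : (z : Mat p 2) 0 0 * (k : Mat p 2) 0 0 + (z : Mat p 2) 0 1 * (k : Mat p 2) 1 0 =
      (z : Mat p 2) 0 0 := by
    have h := congr_arg (fun x : GLm p 2 => (x : Mat p 2) 0 0) e
    simp only [gl2_mul_apply] at h
    linear_combination h + hfix0
  have e10 : (z : Mat p 2) 1 0 * (k : Mat p 2) 0 0 + (z : Mat p 2) 1 1 * (k : Mat p 2) 1 0 =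
      (z : Mat p 2) 1 0 := by
    have h := congr_arg (fun x : GLm p 2 => (x : Mat p 2) 1 0) e
    simp only [gl2_mul_apply] at h
    linear_combination h + hfix1
  have hD : (z : Mat p 2) 0 0 * (z : Mat p 2) 1 1 - (z : Mat p 2) 0 1 * (z : Mat p 2) 1 0 ≠ 0 := by
    have h := Matrix.GeneralLinearGroup.det_ne_zero z
    rwa [Matrix.det_fin_two] at h
  have hk00 : (k : Mat p 2) 0 0 = 1 := by
    have h : ((z : Mat p 2) 0 0 * (z : Mat p 2) 1 1 - (z : Mat p 2) 0 1 * (z : Mat p 2) 1 0) *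
        ((k : Mat p 2) 0 0 - 1) = 0 := by
      linear_combination (z : Mat p 2) 1 1 * e00 - (z : Mat p 2) 0 1 * e10
    exact sub_eq_zero.1 ((mul_eq_zero.1 h).resolve_left hD)
  have hk10 : (k : Mat p 2) 1 0 = 0 := by
    have h : ((z : Mat p 2) 0 0 * (z : Mat p 2) 1 1 - (z : Mat p 2) 0 1 * (z : Mat p 2) 1 0) *
        (k : Mat p 2) 1 0 = 0 := by
      linear_combination -(z : Mat p 2) 1 0 * e00 + (z : Mat p 2) 0 0 * e10
    exact (mul_eq_zero.1 h).resolve_left hD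
  have hk11 : (k : Mat p 2) 1 1 = 1 := by
    rw [Matrix.det_fin_two, hk00, hk10, one_mul, mul_zero, sub_zero] at hdk
    exact hdk
  exact ⟨hk10, hk00, hk11⟩

/-! ### Root subgroups inside a subgroup -/

/-- One upper unitriangular `k ∈ L` with `k₀₁ ≠ 0` gives `U⁺ ≤ L` (`k^n = E₁₂(n k₀₁)`). -/
theorem upper_mem_of_mem {L : Subgroup (GLm p 2)} {k : GLm p 2} (hk : k ∈ L)
    (k10 : (k : Mat p 2) 1 0 = 0) (k00 : (k : Mat p 2) 0 0 = 1) (k11 : (k : Mat p 2) 1 1 = 1)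
    (k01 : (k : Mat p 2) 0 1 ≠ 0) (u : GLm p 2) (u10 : (u : Mat p 2) 1 0 = 0)
    (u00 : (u : Mat p 2) 0 0 = 1) (u11 : (u : Mat p 2) 1 1 = 1) : u ∈ L := by
  have hpow : ∀ n : ℕ, ((k ^ n : GLm p 2) : Mat p 2) 1 0 = 0 ∧
      ((k ^ n : GLm p 2) : Mat p 2) 0 0 = 1 ∧ ((k ^ n : GLm p 2) : Mat p 2) 1 1 = 1 ∧
      ((k ^ n : GLm p 2) : Mat p 2) 0 1 = (n : ZMod p) * (k : Mat p 2) 0 1 := by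
    intro n
    induction n with
    | zero =>
      rw [pow_zero]
      refine ⟨(gl2_one_apply (p := p)).2.2.1, (gl2_one_apply (p := p)).1,
        (gl2_one_apply (p := p)).2.2.2, ?_⟩
      rw [(gl2_one_apply (p := p)).2.1, Nat.cast_zero, zero_mul]
    | succ n ih =>
      obtain ⟨a, b, c, d⟩ := ih
      rw [pow_succ]
      refine ⟨?_, ?_, ?_, ?_⟩
      · rw [gl2_mul_apply, a, c, k10, k00]; ring
      · rw [gl2_mul_apply, b, d, k00, k10]; ring
      · rw [gl2_mul_apply, a, c, k11]; ring
      · rw [gl2_mul_apply, b, d, k11, Nat.cast_succ]; ring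
  haveI : NeZero p := ⟨hp.out.ne_zero⟩
  obtain ⟨h10, h00, h11, h01⟩ := hpow ((u : Mat p 2) 0 1 / (k : Mat p 2) 0 1).val
  rw [ZMod.natCast_zmod_val, div_mul_cancel₀ _ k01] at h01
  have hu : u = k ^ ((u : Mat p 2) 0 1 / (k : Mat p 2) 0 1).val :=
    gl2_ext (by rw [u00, h00]) h01.symm (by rw [u10, h10]) (by rw [u11, h11])
  rw [hu]
  exact L.pow_mem hk _

/-- **THE ROOT LEMMA.**  If `U⁺ ≤ L` and some `h ∈ L` has `h₁₀ ≠ 0`, then `U⁻ ≤ L`: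
with `g = E₁₂(-h₀₀/h₁₀) h ∈ L` (so `g₀₀ = 0`) one has `E₂₁(s) g = g E₁₂(s g₀₁/h₁₀)`. -/
theorem lower_mem_of_upper_mem {L : Subgroup (GLm p 2)}
    (hU : ∀ u : GLm p 2, (u : Mat p 2) 1 0 = 0 → (u : Mat p 2) 0 0 = 1 → (u : Mat p 2) 1 1 = 1 →
      u ∈ L)
    {h : GLm p 2} (hh : h ∈ L) (hc : (h : Mat p 2) 1 0 ≠ 0) (u : GLm p 2)
    (u01 : (u : Mat p 2) 0 1 = 0) (u00 : (u : Mat p 2) 0 0 = 1) (u11 : (u : Mat p 2) 1 1 = 1) :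
    u ∈ L := by
  obtain ⟨x, x00, x01, x10, x11⟩ :=
    exists_gl2 (1 : ZMod p) (-(h : Mat p 2) 0 0 / (h : Mat p 2) 1 0) 0 1 (by simp)
  have hx : x ∈ L := hU x x10 x00 x11
  obtain ⟨g, hg⟩ : ∃ g : GLm p 2, g = x * h := ⟨_, rfl⟩
  have hgL : g ∈ L := by
    rw [hg]
    exact L.mul_mem hx hh
  have g00 : (g : Mat p 2) 0 0 = 0 := by
    rw [hg, gl2_mul_apply, x00, x01, one_mul, div_mul_cancel₀ _ hc, add_neg_cancel]
  have g10 : (g : Mat p 2) 1 0 = (h : Mat p 2) 1 0 := by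
    rw [hg, gl2_mul_apply, x10, x11]; ring
  obtain ⟨y, y00, y01, y10, y11⟩ :=
    exists_gl2 (1 : ZMod p) ((u : Mat p 2) 1 0 * (g : Mat p 2) 0 1 / (h : Mat p 2) 1 0) 0 1
      (by simp)
  have hy : y ∈ L := hU y y10 y00 y11
  have key : u * g = g * y := by
    apply gl2_ext
    · rw [gl2_mul_apply, gl2_mul_apply, u00, u01, g00, y00, y10]; ring
    · rw [gl2_mul_apply, gl2_mul_apply, u00, u01, g00, y11]; ring
    · rw [gl2_mul_apply, gl2_mul_apply, g00, u11, y00, y10]; ring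
    · rw [gl2_mul_apply, gl2_mul_apply, u11, y01, y11, g10]
      field_simp
  have hu : u = g * y * g⁻¹ := by
    rw [← key, mul_inv_cancel_right]
  rw [hu]
  exact L.mul_mem (L.mul_mem hgL hy) (L.inv_mem hgL)

/-- **`U⁺` inside a conjugate.**  If `g ∈ H`, `g ≠ 1`, `det g = 1` and `g` fixes the first column
of `z`, then `U⁺ ≤ z⁻¹ H z`. -/
theorem upper_le_map_conj {H : Subgroup (GLm p 2)} {g z : GLm p 2} (hg : g ∈ H) (hg1 : g ≠ 1)
    (hdet : (g : Mat p 2).det = 1)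
    (hfix0 : (g : Mat p 2) 0 0 * (z : Mat p 2) 0 0 + (g : Mat p 2) 0 1 * (z : Mat p 2) 1 0 =
      (z : Mat p 2) 0 0)
    (hfix1 : (g : Mat p 2) 1 0 * (z : Mat p 2) 0 0 + (g : Mat p 2) 1 1 * (z : Mat p 2) 1 0 =
      (z : Mat p 2) 1 0) :
    ∀ u : GLm p 2, (u : Mat p 2) 1 0 = 0 → (u : Mat p 2) 0 0 = 1 → (u : Mat p 2) 1 1 = 1 →
      u ∈ H.map (MulAut.conj z⁻¹).toMonoidHom := by
  obtain ⟨k10, k00, k11⟩ := conj_upper_of_fixed_col hfix0 hfix1 hdet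
  have hk : z⁻¹ * g * z ∈ H.map (MulAut.conj z⁻¹).toMonoidHom := by
    rw [mem_map_conj_inv_iff]
    have e : z * (z⁻¹ * g * z) * z⁻¹ = g := by group
    rw [e]
    exact hg
  have k01 : ((z⁻¹ * g * z : GLm p 2) : Mat p 2) 0 1 ≠ 0 := by
    intro h0
    apply hg1
    have hk1 : z⁻¹ * g * z = 1 :=
      gl2_ext (k00.trans (gl2_one_apply (p := p)).1.symm)
        (h0.trans (gl2_one_apply (p := p)).2.1.symm)
        (k10.trans (gl2_one_apply (p := p)).2.2.1.symm)
        (k11.trans (gl2_one_apply (p := p)).2.2.2.symm)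
    calc g = z * (z⁻¹ * g * z) * z⁻¹ := by group
      _ = 1 := by rw [hk1]; group
  exact upper_mem_of_mem hk k10 k00 k11 k01

/-- **A COMMON FIXED LINE FORCES A COMMON NON-TRIVIAL ELEMENT.**  If `g ∈ H`, `g' ∈ H'` are
non-trivial of determinant `1` with a common non-zero fixed vector, then `H ⊓ H' ≠ ⊥`. -/
theorem not_disjoint_of_common_fixed {H H' : Subgroup (GLm p 2)} {g g' : GLm p 2}
    (hg : g ∈ H) (hg' : g' ∈ H') (hg1 : g ≠ 1) (hg'1 : g' ≠ 1)
    (hdet : (g : Mat p 2).det = 1) (hdet' : (g' : Mat p 2).det = 1) {v : Fin 2 → ZMod p}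
    (hv : v ≠ 0)
    (hfix : (g : Mat p 2) 0 0 * v 0 + (g : Mat p 2) 0 1 * v 1 = v 0 ∧
      (g : Mat p 2) 1 0 * v 0 + (g : Mat p 2) 1 1 * v 1 = v 1)
    (hfix' : (g' : Mat p 2) 0 0 * v 0 + (g' : Mat p 2) 0 1 * v 1 = v 0 ∧
      (g' : Mat p 2) 1 0 * v 0 + (g' : Mat p 2) 1 1 * v 1 = v 1) :
    ¬ Disjoint H H' := by
  intro hdis
  obtain ⟨z, z00, z10⟩ := exists_gl2_col hv
  obtain ⟨u, u00, u01, u10, u11⟩ := exists_gl2 (1 : ZMod p) 1 0 1 (by simp)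
  have hu : u ∈ H.map (MulAut.conj z⁻¹).toMonoidHom :=
    upper_le_map_conj hg hg1 hdet (by rw [z00, z10]; exact hfix.1)
      (by rw [z00, z10]; exact hfix.2) u u10 u00 u11
  have hu' : u ∈ H'.map (MulAut.conj z⁻¹).toMonoidHom :=
    upper_le_map_conj hg' hg'1 hdet' (by rw [z00, z10]; exact hfix'.1)
      (by rw [z00, z10]; exact hfix'.2) u u10 u00 u11
  rw [mem_map_conj_inv_iff] at hu hu'
  have h1 : z * u * z⁻¹ = 1 := Subgroup.disjoint_def.1 hdis hu hu'
  have hu1 : u = 1 := by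
    calc u = z⁻¹ * (z * u * z⁻¹) * z := by group
      _ = 1 := by rw [h1]; group
  have h01 : (u : Mat p 2) 0 1 = 0 := by
    rw [hu1]
    exact (gl2_one_apply (p := p)).2.1
  rw [u01] at h01
  exact one_ne_zero h01

/-! ### Moving `U⁺` to `U_{[1:1]}` and to `U⁻`: conjugation by `m = [[1,0],[1,1]]` and
`w = [[0,1],[1,0]]` -/

/-- Entries of `m⁻¹ x m` for `m = [[1,0],[1,1]]` (`m⁻¹ = [[1,0],[-1,1]]`). -/
theorem conj_m_apply {m : GLm p 2} (m00 : (m : Mat p 2) 0 0 = 1) (m01 : (m : Mat p 2) 0 1 = 0)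
    (m10 : (m : Mat p 2) 1 0 = 1) (m11 : (m : Mat p 2) 1 1 = 1) (x : GLm p 2) :
    ((m⁻¹ * x * m : GLm p 2) : Mat p 2) 0 0 = (x : Mat p 2) 0 0 + (x : Mat p 2) 0 1 ∧
    ((m⁻¹ * x * m : GLm p 2) : Mat p 2) 0 1 = (x : Mat p 2) 0 1 ∧
    ((m⁻¹ * x * m : GLm p 2) : Mat p 2) 1 0 =
      (x : Mat p 2) 1 0 + (x : Mat p 2) 1 1 - ((x : Mat p 2) 0 0 + (x : Mat p 2) 0 1) ∧
    ((m⁻¹ * x * m : GLm p 2) : Mat p 2) 1 1 = (x : Mat p 2) 1 1 - (x : Mat p 2) 0 1 := by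
  obtain ⟨m', n00, n01, n10, n11⟩ := exists_gl2 (1 : ZMod p) 0 (-1) 1 (by simp)
  have hm' : m' * m = 1 := by
    apply gl2_ext
    · rw [gl2_mul_apply, n00, n01, m00, m10, (gl2_one_apply (p := p)).1]; ring
    · rw [gl2_mul_apply, n00, n01, m01, m11, (gl2_one_apply (p := p)).2.1]; ring
    · rw [gl2_mul_apply, n10, n11, m00, m10, (gl2_one_apply (p := p)).2.2.1]; ring
    · rw [gl2_mul_apply, n10, n11, m01, m11, (gl2_one_apply (p := p)).2.2.2]; ring
  have hinv : m⁻¹ = m' := inv_eq_of_mul_eq_one_left hm'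
  obtain ⟨y, hy⟩ : ∃ y : GLm p 2, y = m' * x := ⟨_, rfl⟩
  rw [hinv, ← hy]
  have y00 : (y : Mat p 2) 0 0 = (x : Mat p 2) 0 0 := by
    rw [hy, gl2_mul_apply, n00, n01]; ring
  have y01 : (y : Mat p 2) 0 1 = (x : Mat p 2) 0 1 := by
    rw [hy, gl2_mul_apply, n00, n01]; ring
  have y10 : (y : Mat p 2) 1 0 = -(x : Mat p 2) 0 0 + (x : Mat p 2) 1 0 := by
    rw [hy, gl2_mul_apply, n10, n11]; ring
  have y11 : (y : Mat p 2) 1 1 = -(x : Mat p 2) 0 1 + (x : Mat p 2) 1 1 := by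
    rw [hy, gl2_mul_apply, n10, n11]; ring
  refine ⟨?_, ?_, ?_, ?_⟩
  · rw [gl2_mul_apply, y00, y01, m00, m10]; ring
  · rw [gl2_mul_apply, y00, y01, m01, m11]; ring
  · rw [gl2_mul_apply, y10, y11, m00, m10]; ring
  · rw [gl2_mul_apply, y10, y11, m01, m11]; ring

/-- Entries of `w⁻¹ x w` for the Weyl element `w = [[0,1],[1,0]]` (`w⁻¹ = w`). -/
theorem conj_w_apply {w : GLm p 2} (w00 : (w : Mat p 2) 0 0 = 0) (w01 : (w : Mat p 2) 0 1 = 1)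
    (w10 : (w : Mat p 2) 1 0 = 1) (w11 : (w : Mat p 2) 1 1 = 0) (x : GLm p 2) :
    ((w⁻¹ * x * w : GLm p 2) : Mat p 2) 0 0 = (x : Mat p 2) 1 1 ∧
    ((w⁻¹ * x * w : GLm p 2) : Mat p 2) 0 1 = (x : Mat p 2) 1 0 ∧
    ((w⁻¹ * x * w : GLm p 2) : Mat p 2) 1 0 = (x : Mat p 2) 0 1 ∧
    ((w⁻¹ * x * w : GLm p 2) : Mat p 2) 1 1 = (x : Mat p 2) 0 0 := by
  have hw : w * w = 1 := by
    apply gl2_ext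
    · rw [gl2_mul_apply, w00, w01, w10, (gl2_one_apply (p := p)).1]; ring
    · rw [gl2_mul_apply, w00, w01, w11, (gl2_one_apply (p := p)).2.1]; ring
    · rw [gl2_mul_apply, w10, w11, w00, (gl2_one_apply (p := p)).2.2.1]; ring
    · rw [gl2_mul_apply, w10, w11, w01, (gl2_one_apply (p := p)).2.2.2]; ring
  have hinv : w⁻¹ = w := inv_eq_of_mul_eq_one_left hw
  obtain ⟨y, hy⟩ : ∃ y : GLm p 2, y = w * x := ⟨_, rfl⟩
  rw [hinv, ← hy]
  have y00 : (y : Mat p 2) 0 0 = (x : Mat p 2) 1 0 := by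
    rw [hy, gl2_mul_apply, w00, w01]; ring
  have y01 : (y : Mat p 2) 0 1 = (x : Mat p 2) 1 1 := by
    rw [hy, gl2_mul_apply, w00, w01]; ring
  have y10 : (y : Mat p 2) 1 0 = (x : Mat p 2) 0 0 := by
    rw [hy, gl2_mul_apply, w10, w11]; ring
  have y11 : (y : Mat p 2) 1 1 = (x : Mat p 2) 0 1 := by
    rw [hy, gl2_mul_apply, w10, w11]; ring
  refine ⟨?_, ?_, ?_, ?_⟩
  · rw [gl2_mul_apply, y00, y01, w00, w10]; ring
  · rw [gl2_mul_apply, y00, y01, w01, w11]; ring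
  · rw [gl2_mul_apply, y10, y11, w00, w10]; ring
  · rw [gl2_mul_apply, y10, y11, w01, w11]; ring

end Transvections

end Summit.MatrixMultiplication.MatrixMultiplication.Theorems.SubgroupIdentityDesigns.Negative
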